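import Literature.NumberTheory.Sieve.BombieriFriedlanderIwaniecDyadic
import Literature.NumberTheory.Sieve.HeathBrownIdentity
import HarnessLib

/-!
# Bombieri–Friedlander–Iwaniec 1986, §15: Heath-Brown's identity applied to the sifted dyadic sums

Trunk `AntSieve`, companion to `Literature.NumberTheory.Sieve.BombieriFriedlanderIwaniecDyadic`
(the DAG `bfi_wellFactorable_level ⇐ Theorem10 ⇐ Theorem10Dyadic ⇐ Theorem10DyadicSifted z`, all
arrows proved) and `Literature.NumberTheory.Sieve.HeathBrownIdentity` (BFI Lemma 5, proved).
Everything here is PROVED.  This is the first step of BFI §15 (p. 244: "Next, we apply Lemma 5 with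
`J = 7` for any `n` from (15.1)") on the way from the bilinear Theorems 1, 2, 5*
(`…BombieriFriedlanderIwaniecDispersion`) to `Theorem10DyadicSifted`:

* `Literature.BFI.sievedDisc F q a z x` — the sifted dyadic discrepancy of an ARBITRARY sequence `F`,
  `∑_{x<n≤2x, n≡a (q), (n,P(z))=1} F(n) − φ(q)⁻¹ ∑_{x<n≤2x, (n,qP(z))=1} F(n)`; it is linear in `F`
  (`sievedDisc_add`, `sievedDisc_smul`, `sievedDisc_sum`) and depends only on `F` on `(x, 2x]`
  (`sievedDisc_congr`); `dyadDiscSifted q a z x = sievedDisc Λ q a z x` (`dyadDiscSifted_eq_sievedDisc`).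
* `Literature.BFI.hbPiece U j = μ_{≤U}^{⋆j} ⋆ 1^{⋆(j−1)} ⋆ log` — the `j`-th Heath-Brown convolution
  (BFI (2.1) with `x^{1/J}` replaced by the integer truncation `U`), an `ArithmeticFunction ℝ`.
* `Literature.NumberTheory.Sieve.BFI.dyadDiscSifted_eq_sum_hbPiece` — for `⌊2x⌋ ≤ U⁷`:
  `E_z(x; q, a) = ∑_{j=1}^{7} (−1)^{j+1} C(7, j) · sievedDisc (hbPiece U j) q a z x` (BFI p. 244).
* Tools for the next step (grouping the `2j` factors into `α ⋆ β`, BFI p. 246): divisors of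
  `z`-rough numbers are `z`-rough (`IsRough.of_dvd`), so every factor of a Heath-Brown convolution
  may be restricted to `z`-rough integers without changing its values at `z`-rough `n`
  (`roughRestrict`, `roughRestrict_mul_apply`); and the weighted expansion of a Dirichlet
  convolution over `n ≤ N` as a double sum (`sum_Ioc_mul_apply_mul`, after Mathlib's
  `ArithmeticFunction.sum_Ioc_mul_eq_sum_prod_filter`).

## References

* E. Bombieri, J. B. Friedlander, H. Iwaniec, *Primes in arithmetic progressions to large moduli*,
  Acta Math. 156 (1986), 203–251, §2 Lemma 5 (2.1) p. 211 and §15 pp. 244–246.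
  [BombieriFriedlanderIwaniecActa1986]
-/

open Finset Real
open scoped ArithmeticFunction.vonMangoldt ArithmeticFunction.zeta

namespace Literature.NumberTheory.Sieve

namespace BFI

/-! ### The sifted dyadic discrepancy of a general sequence -/

/-- The sifted dyadic discrepancy of a sequence `F` at the modulus `q`, residue `a`, sifting level
`z`: `∑_{x<n≤2x, n≡a (q), (n,P(z))=1} F(n) − φ(q)⁻¹ ∑_{x<n≤2x, (n,q)=1, (n,P(z))=1} F(n)` (BFI (15.1),
p. 244, and the sums `ℰ`, `Δ(…; q, a)` of p. 245 for the Heath-Brown pieces).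
[cite: BombieriFriedlanderIwaniecActa1986, §15 (15.1) p. 244] -/
noncomputable def sievedDisc (F : ℕ → ℝ) (q : ℕ) (a : ℤ) (z x : ℝ) : ℝ :=
  (∑ n ∈ Ioc ⌊x⌋₊ ⌊2 * x⌋₊, if IsRough z n ∧ (n : ZMod q) = (a : ZMod q) then F n else 0) -
    (∑ n ∈ Ioc ⌊x⌋₊ ⌊2 * x⌋₊, if IsRough z n ∧ n.Coprime q then F n else 0) / (Nat.totient q : ℝ)

/-- `E_z(x; q, a) = sievedDisc Λ q a z x`: the sifted discrepancy of BFI (15.1) is the functional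
`sievedDisc` at the von Mangoldt function. [cite: BombieriFriedlanderIwaniecActa1986, §15 (15.1) p. 244] -/
theorem dyadDiscSifted_eq_sievedDisc (q : ℕ) (a : ℤ) (z x : ℝ) :
    dyadDiscSifted q a z x = sievedDisc (fun n => Λ n) q a z x := by
  unfold dyadDiscSifted sievedDisc psiDyadModSifted psiDyadCoprimeSifted
  congr 1
  · refine Finset.sum_congr rfl fun n _ => ?_
    simp only [ArithmeticFunction.vonMangoldt.residueClass, Set.indicator_apply, Set.mem_setOf_eq]
    by_cases h1 : IsRough z n <;> by_cases h2 : (n : ZMod q) = (a : ZMod q) <;> simp [h1, h2]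
  · congr 1
    refine Finset.sum_congr rfl fun n _ => ?_
    by_cases h1 : IsRough z n <;> by_cases h2 : n.Coprime q <;> simp [h1, h2]

/-- `sievedDisc` depends only on the values of `F` on `(x, 2x]`. [folklore] -/
theorem sievedDisc_congr {F G : ℕ → ℝ} {x : ℝ} (h : ∀ n ∈ Ioc ⌊x⌋₊ ⌊2 * x⌋₊, F n = G n)
    (q : ℕ) (a : ℤ) (z : ℝ) : sievedDisc F q a z x = sievedDisc G q a z x := by
  unfold sievedDisc
  congr 1
  · exact Finset.sum_congr rfl fun n hn => by rw [h n hn]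
  · congr 1
    exact Finset.sum_congr rfl fun n hn => by rw [h n hn]

/-- Additivity of `sievedDisc` in `F`. [folklore] -/
theorem sievedDisc_add (F G : ℕ → ℝ) (q : ℕ) (a : ℤ) (z x : ℝ) :
    sievedDisc (fun n => F n + G n) q a z x = sievedDisc F q a z x + sievedDisc G q a z x := by
  unfold sievedDisc
  have h1 : ∀ (P : ℕ → Prop) [DecidablePred P],
      (∑ n ∈ Ioc ⌊x⌋₊ ⌊2 * x⌋₊, if P n then F n + G n else 0) =
        (∑ n ∈ Ioc ⌊x⌋₊ ⌊2 * x⌋₊, if P n then F n else 0) +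
          ∑ n ∈ Ioc ⌊x⌋₊ ⌊2 * x⌋₊, if P n then G n else 0 := by
    intro P _
    rw [← Finset.sum_add_distrib]
    exact Finset.sum_congr rfl fun n _ => by split_ifs <;> ring
  rw [h1, h1]
  ring

/-- Homogeneity of `sievedDisc` in `F`. [folklore] -/
theorem sievedDisc_smul (c : ℝ) (F : ℕ → ℝ) (q : ℕ) (a : ℤ) (z x : ℝ) :
    sievedDisc (fun n => c * F n) q a z x = c * sievedDisc F q a z x := by
  unfold sievedDisc
  have h1 : ∀ (P : ℕ → Prop) [DecidablePred P],
      (∑ n ∈ Ioc ⌊x⌋₊ ⌊2 * x⌋₊, if P n then c * F n else 0) =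
        c * ∑ n ∈ Ioc ⌊x⌋₊ ⌊2 * x⌋₊, if P n then F n else 0 := by
    intro P _
    rw [Finset.mul_sum]
    exact Finset.sum_congr rfl fun n _ => by split_ifs <;> ring
  rw [h1, h1]
  ring

/-- Linearity of `sievedDisc` over finite sums with coefficients. [folklore] -/
theorem sievedDisc_sum {ι : Type*} (s : Finset ι) (c : ι → ℝ) (F : ι → ℕ → ℝ) (q : ℕ) (a : ℤ)
    (z x : ℝ) :
    sievedDisc (fun n => ∑ i ∈ s, c i * F i n) q a z x = ∑ i ∈ s, c i * sievedDisc (F i) q a z x := by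
  classical
  induction s using Finset.induction_on with
  | empty =>
    simp only [Finset.sum_empty]
    unfold sievedDisc
    simp
  | @insert i s hi ih =>
    simp only [Finset.sum_insert hi]
    rw [← ih, ← sievedDisc_smul, ← sievedDisc_add]

/-! ### Heath-Brown's identity applied to `E_z` -/

/-- The `j`-th Heath-Brown convolution with truncation `U` (BFI (2.1), p. 211, with `m_i ≤ U`):
`hbPiece U j = μ_{≤U}^{⋆ j} ⋆ 1^{⋆ (j−1)} ⋆ log`, i.e.
`n ↦ ∑_{m₁⋯m_j n₁⋯n_j = n, m_i ≤ U} μ(m₁)⋯μ(m_j) log n₁`, as a real arithmetic function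
(`Literature.NumberTheory.Sieve.moebiusTrunc`). [cite: BombieriFriedlanderIwaniecActa1986, §2 Lemma 5 (2.1) p. 211] -/
noncomputable def hbPiece (U j : ℕ) : ArithmeticFunction ℝ :=
  (moebiusTrunc U : ArithmeticFunction ℝ) ^ j * (ζ : ArithmeticFunction ℝ) ^ (j - 1) *
    ArithmeticFunction.log

/-- **BFI §15, first step** (p. 244: "we apply Lemma 5 with `J = 7` for any `n` from (15.1)"): if
`⌊2x⌋ ≤ U⁷` then
`E_z(x; q, a) = ∑_{j=1}^{7} (−1)^{j+1} C(7, j) · sievedDisc (hbPiece U j) q a z x`.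
PROVED from `Literature.NumberTheory.Sieve.heathBrown_identity_nat` and the linearity of `sievedDisc`.
[cite: BombieriFriedlanderIwaniecActa1986, §15 p. 244] -/
theorem dyadDiscSifted_eq_sum_hbPiece {x : ℝ} {U : ℕ} (hU : ⌊2 * x⌋₊ ≤ U ^ 7) (q : ℕ) (a : ℤ)
    (z : ℝ) :
    dyadDiscSifted q a z x =
      ∑ j ∈ Icc 1 7, (-1 : ℝ) ^ (j + 1) * (Nat.choose 7 j : ℝ) * sievedDisc (fun n => hbPiece U j n) q a z x := by
  rw [dyadDiscSifted_eq_sievedDisc]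
  have hcongr : ∀ n ∈ Ioc ⌊x⌋₊ ⌊2 * x⌋₊, (Λ n : ℝ) =
      ∑ j ∈ Icc 1 7, ((-1 : ℝ) ^ (j + 1) * (Nat.choose 7 j : ℝ)) * hbPiece U j n := by
    intro n hn
    have hn7 : n ≤ U ^ 7 := (mem_Ioc.1 hn).2.trans hU
    rw [heathBrown_identity_nat (K := 7) (by norm_num) U hn7]
    rfl
  rw [sievedDisc_congr hcongr, sievedDisc_sum]

/-! ### Tools for grouping the factors: rough restriction and the double-sum expansion -/

/-- Divisors of a `z`-rough positive integer are `z`-rough. [folklore] -/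
theorem IsRough.of_dvd {z : ℝ} {n d : ℕ} (h : IsRough z n) (hd : d ∣ n) (hn : n ≠ 0) :
    IsRough z d :=
  fun p hp => h p (Nat.primeFactors_mono hd hn hp)

/-- The restriction `F · 1_{(·, P(z)) = 1}` of an arithmetic function to `z`-rough integers.
[cite: BombieriFriedlanderIwaniecActa1986, §15 p. 245 (the starred sums `Σ*`)] -/
noncomputable def roughRestrict (z : ℝ) (F : ArithmeticFunction ℝ) : ArithmeticFunction ℝ where
  toFun n := if IsRough z n then F n else 0
  map_zero' := by simp

/-- Unfolding lemma for `roughRestrict`. [folklore] -/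
theorem roughRestrict_apply (z : ℝ) (F : ArithmeticFunction ℝ) (n : ℕ) :
    roughRestrict z F n = if IsRough z n then F n else 0 := rfl

/-- At a `z`-rough `n`, restricting both factors of a Dirichlet convolution to `z`-rough integers
changes nothing (every factorisation `n = d e` has `d`, `e` rough): BFI's passage to the starred sums
`Σ*` on p. 245. [cite: BombieriFriedlanderIwaniecActa1986, §15 p. 245] -/
theorem roughRestrict_mul_apply {z : ℝ} (F G : ArithmeticFunction ℝ) {n : ℕ} (hn : IsRough z n) :
    (roughRestrict z F * roughRestrict z G) n = (F * G) n := by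
  rcases Nat.eq_zero_or_pos n with rfl | hpos
  · simp
  rw [ArithmeticFunction.mul_apply, ArithmeticFunction.mul_apply]
  refine Finset.sum_congr rfl fun p hp => ?_
  rw [Nat.mem_divisorsAntidiagonal] at hp
  have h1 : IsRough z p.1 := hn.of_dvd (Dvd.intro _ hp.1) hp.2
  have h2 : IsRough z p.2 := hn.of_dvd (Dvd.intro_left _ hp.1) hp.2
  rw [roughRestrict_apply, roughRestrict_apply, if_pos h1, if_pos h2]

/-- The rough restriction is itself supported on rough integers, so it can be applied to a
convolution of restricted factors once more: `(F♭ ⋆ G♭)♭ = (F ⋆ G)♭` with `♭ = roughRestrict z`.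
[folklore] -/
theorem roughRestrict_mul_roughRestrict (z : ℝ) (F G : ArithmeticFunction ℝ) :
    roughRestrict z (roughRestrict z F * roughRestrict z G) = roughRestrict z (F * G) := by
  ext n
  rw [roughRestrict_apply, roughRestrict_apply]
  split_ifs with h
  · exact roughRestrict_mul_apply F G h
  · rfl

/-- Weighted expansion of a Dirichlet convolution over `n ≤ N` (after Mathlib's
`ArithmeticFunction.sum_Ioc_mul_eq_sum_prod_filter`): for any weight `h`,
`∑_{n ≤ N} (f ⋆ g)(n) h(n) = ∑_{d e ≤ N} f(d) g(e) h(de)`. [folklore] -/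
theorem sum_Ioc_mul_apply_mul (f g : ArithmeticFunction ℝ) (h : ℕ → ℝ) (N : ℕ) :
    ∑ n ∈ Ioc 0 N, (f * g) n * h n =
      ∑ x ∈ (Ioc 0 N ×ˢ Ioc 0 N).filter (fun x => x.1 * x.2 ≤ N), f x.1 * g x.2 * h (x.1 * x.2) := by
  simp only [ArithmeticFunction.mul_apply, Finset.sum_mul]
  trans ∑ n ∈ Ioc 0 N, ∑ x ∈ (Ioc 0 N ×ˢ Ioc 0 N).filter (fun x => x.1 * x.2 = n),
    f x.1 * g x.2 * h (x.1 * x.2)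
  · refine Finset.sum_congr rfl fun n hn => ?_
    simp only [mem_Ioc] at hn
    rw [Nat.divisorsAntidiagonal_eq_prod_filter_of_le hn.1.ne' hn.2]
    refine Finset.sum_congr rfl fun x hx => ?_
    rw [(Finset.mem_filter.1 hx).2]
  · simp_rw [Finset.sum_filter]
    rw [Finset.sum_comm]
    exact Finset.sum_congr rfl fun _ _ => by simp_all

end BFI

end Literature.NumberTheory.Sieve
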